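import Mathlib.Tactic
import Literature.Geometry.Lorentzian.KlainermanSzeftel2021.InitializationLedger

/-!
# Theorems M0-PT and M8: the printed derivative budgets of the two frame-change passages of [KS] chapter 9 ([J] §9.5 Steps 17'–24', [J] §9.4.3 Steps 1–6)

CITATION HEADER (lean-in-tree rule 2026-08-18).  Kernel-checked transcription of INTEGER BOOKKEEPING printed in
* [KS] S. Klainerman, J. Szeftel, *Kerr stability for small angular momentum*, Pure Appl. Math. Q. **19** (2023) no. 3, 791–1678
  = bib key `KlainermanSzeftel2023` ([J]), read as the authors' accepted version HAL hal-04280491 (`HAL p.N Ln` = PDF page N, text line n;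
  printed page = N − 1), AND as the e-print arXiv:2104.11857v1 = bib key `KlainermanSzeftel2021` (TeX `Main-Kerr-arxiv.tex`, `v1 l.N`, labels);
  at every locus quoted below the two texts print the SAME integer and the same words (including the three slips recorded in §1.5/§3).
Display and section numbers are [J]'s: [J] §9.4.3 "Proof of Theorem M8" = v1 `sec:endoftheproofofTheoremM8:chap9` (l.24070–24299); [J] §9.5
"Proof of Theorem 9.4.12" (Theorem M0-PT) = v1 §9.8 `sec:proofof:Theorem:TheoremM0-PT` (l.24748–25167), whose steps are printed `Step 1'`–`Step 24'`.

WHAT IS TRANSCRIBED.  Only displayed derivative indices `k ≤ k_large + n` (as functions of `kl = k_large`) and the losses the text NAMES in words: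
* §1 Theorem M0-PT (Thm 9.4.12, (9.4.22) `(PT)𝓘_k ≲ ε₀, k ≤ k_large + 7`): the local bootstrap assumptions (9.5.3)/(9.5.4) at `k_large + 7`,
  the GCM sphere `S'_1` at `k_large + 8` ((9.5.5)), Step 17' (BA-PT on `Σ_*` (9.5.8); "the trace theorem" `‖Γ_b'‖_{𝔥_k(S_*)} ≲ ‖𝔡_*^{≤k+1}Γ_b'‖_{L²(Σ_*)}`;
  (9.5.9)), Steps 19'–22' on `{u' = 1}` ((9.5.10)–(9.5.18)), Step 23' on `{u̲' = 1}` ((9.5.19), (9.5.20), footnote 19), Step 24'.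
* §2 Theorem 9.4.10 ((9.4.14) at `k_large + 7`, one above the range `J ≤ k_large + 6` of the iteration, Thm 9.4.15) and Theorem M8, §9.4.3
  Steps 1–6: (9.4.16) on `Σ_*`; (9.4.17) "together with Sobolev and the trace theorem … for `k ≤ k_large + 4`"; (9.4.18), (9.4.19); the ingoing
  PG frames of `(top)ℳ` / `(int)ℳ` at `k_large + 4` (`f̲', log λ'`) and `k_large + 3` (`f'`); "for `k ≤ k_large + 2`" for the Ricci
  coefficients; the coordinate differences at `k_large + 3`; the concluding display `𝔑^{(Sup)}_{k_large+2} ≲ ε₀` — set against the STATEMENT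
  of Theorem M8, `𝔑^{(Sup)}_{k_large} ≲ ε₀`.
* §3 the comparison with Theorem M0 (`InitializationLedger` §1; [J] footnote 13 "the conclusions of Theorem M0 hold for `k ≤ k_large − 2` while
  the ones of Theorem M0-PT hold for `k ≤ k_large + 7`"; Remark 2.8.9 / footnote 14 "unlike the PT frame, the PG frame exhibits a loss of
  derivative") and the end slacks of the five printed budgets M0 / M0-PT / M6 / M7 / M8 now typed in this directory.

WHAT IS CERTIFIED.  ℕ-arithmetic only: which printed index follows from which by the named losses, where each chain closes and with what
slack, and the size of the gap "M0-PT minus M0" itemised on printed levels.  Every `def` is EITHER a printed integer with its locus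
(`[cite: …]`; the docstring quotes the display) OR — for exactly three declarations, `m8Slack`, `step23ReadingA`, `step23ReadingB` — a
derived count resp. one of the two readings of a display whose derivative index and quantified index disagree in print, tagged `[folklore]`
and worded as a reading.  NOTHING analytic (no Sobolev or trace inequality, no transport, elliptic or change-of-frame estimate) is
formalised or asserted: the words "Sobolev", "trace theorem", "loses one derivative", "do not lose derivatives" are QUOTED with their loci,
never proved.  In particular this module counts DERIVATIVES only; whether the r-WEIGHTS of (9.4.17) follow from Definitions 9.4.3–9.4.4 is
the business of `GiorgiKlainermanSzeftel2022.ExteriorWeightLedger` / `CylinderTransportCount` and is not touched here.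

STATUS-RELATION.  Companion to `InitializationLedger` (Theorems M0/M6; p182215), `GCMHRungLedger` (p181526) and `ExtensionRegularityLedger`
(Theorem M7; p181958) of this directory: it uses their constants by name (`primedShift`, `frameToRicciCost`, `curvatureCost`,
`m8IntDisplayLevel`, `m8SupNormLevel`, `targetM0`, `gcmSphereLevel`, `extFbLevel`, `intRFLevel`, `finalM6`, `targetM6`, `smaxM0`;
`sobolevCost`, `prop827Loss`, `dataIndex`; `slack`) and introduces no new reading of theirs (module 42's "§8.4 Step 9" names the
second half of §8.4 Step 8, l.21551–21590 — the cell ledger's item P13; no integer depends on the label).  The root module `Bootstrap`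
types the same theorems only as edges (`ThmM0PT`, `BA_PT`, `MainPT`, `M8ofPT`, index `c.klarge + 7`).
-/

namespace Literature.Geometry.Lorentzian.KlainermanSzeftel2021.FrameChangeLedger

/-! ## §1 Theorem M0-PT ([J] Thm 9.4.12, proof §9.5 = v1 §9.8): the printed levels, as functions of `kl = k_large` -/

/-- Local bootstrap assumptions (9.5.3) `‖f‖_{𝔥_{k_large+7}(S'_1)} + r⁻¹‖(f̲, log λ)‖_{𝔥_{k_large+7}(S'_1)} ≤ ε` and (9.5.4) (`J^{(p)} − J̃^{(p)}`,
"for all `k ≤ k_large + 7`"); Remark 9.5.2: they "hold for `k ≤ k_large + 7`, while their analogs in Theorem M0 hold only for `k ≤ k_large`"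
(there: `InitializationLedger.smaxM0 = k_large`). [cite: KlainermanSzeftel2023, (9.5.3)–(9.5.4), Rem 9.5.2, HAL p.636 L25–45;
KlainermanSzeftel2021, l.24787–24800] -/
def localBALevel (kl : ℕ) : ℕ := kl + 7

/-- (9.5.5), "the following analog of (8.3.33)": `sup_{k ≤ k_large+8} (‖𝔡^k f‖_{L²(S'_1)} + r⁻¹‖𝔡^k(f̲, log λ)‖_{L²(S'_1)} + …) ≲ ε₀` — the GCM
sphere `S'_1` at `k_large + 8` ("Steps 8'–16' … with `k_large` being replaced by `k_large + 7`"). [cite: KlainermanSzeftel2023, (9.5.5),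
HAL p.636 L46–72; KlainermanSzeftel2021, `eq:finalesitateforffbchecklaonS1inproofofThmM0:reallyfinal'`, l.24802–24808] -/
def s1Level (kl : ℕ) : ℕ := kl + 8

/-- Step 17', (9.5.8): `‖𝔡_*^{≤k}Γ_b'‖_{L²(Σ_*)} ≤ ε, k ≤ k_large + 7`, "which follows immediately from the bootstrap assumptions BA-PT"
((9.4.21): `𝔖_k + ℜ_k ≤ ε, k ≤ k_large + 7`). [cite: KlainermanSzeftel2023, (9.5.8) HAL p.637 L13–18, (9.4.21) p.623 L20;
KlainermanSzeftel2021, l.24821–24825, `eq:mainbootassforchapte9` l.24316–24319] -/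
def baPTSigmaStar (kl : ℕ) : ℕ := kl + 7

/-- Step 17', "in view of (9.5.8) and the trace theorem, we have, for `k ≤ k_large + 6`, `‖Γ_b'‖_{𝔥_k(S_*)} ≲ ‖𝔡_*^{≤k+1}Γ_b'‖_{L²(Σ_*)} ≲ ε`.
Hence, for `k + 1 ≤ k_large + 7`, …": the printed cost of the passage `L²(Σ_*) → 𝔥_k(S_*)` is ONE derivative (`k + 1 ↦ k`).
[cite: KlainermanSzeftel2023, HAL p.637 L29–34; KlainermanSzeftel2021, l.24833–24842] -/
def traceCost : ℕ := 1

/-- Step 17': the `Σ_*`-frame Ricci coefficients on the spheres, `Γ_b' ∈ 𝔥_k(S_*)` "for `k ≤ k_large + 6`".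
[cite: KlainermanSzeftel2023, HAL p.637 L29–34; KlainermanSzeftel2021, l.24833–24836] -/
def step17SphereLevel (kl : ℕ) : ℕ := kl + 6

/-- Step 17': `φ ∈ 𝔥_{k+2}(S_*)`, `r'∇f_0' − J'^{(0)}∈ ∈ 𝔥_{k+1}(S_*)` "for `k + 1 ≤ k_large + 7`", then "Integrating from `S_*`, we obtain for
`k ≤ k_large + 7`" these first-derivative quantities in `L^∞_u 𝔥_k(S')` and on `S'_1` ("for all `k ≤ k_large + 7`").
[cite: KlainermanSzeftel2023, HAL p.637 L34 – p.639 L23; KlainermanSzeftel2021, l.24837–24877] -/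
def step17NablaFLevel (kl : ℕ) : ℕ := kl + 7

/-- Step 17', (9.5.9): `r⁻¹‖f_p' − f_p‖_{𝔥_{k+1}(S'_1)} ≲ ε₀` for `k ≤ k_large + 7`, displayed "for all `k ≤ k_large + 8`,
`max_p (r⁻¹‖𝔡_*^{≤k}(f_p' − f_p)‖_{L²(S'_1)} + r⁻¹‖𝔡_*^{≤k}(J'^{(p)} − J^{(p)})‖_{L²(S'_1)}) ≲ ε₀`", which "improves [footnote: both with respect to the
smallness constant and to regularity] the bootstrap assumption (9.5.4)". [cite: KlainermanSzeftel2023, (9.5.9), HAL p.639 L24–59;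
KlainermanSzeftel2021, l.24878–24894] -/
def step17FpLevel (kl : ℕ) : ℕ := kl + 8

/-- Step 19', (9.5.10): the coefficients `(f''', f̲''', log λ''')` (outgoing PG frame of `(ext)L₀` → outgoing PT frame of `(ext)ℳ`) in `L²(S'_1)`,
"`k ≤ k_large + 8`"; Step 19' also recalls the geodesic-frame coefficients at `𝔡^{≤k_large+8}` (= `InitializationLedger.geodesicFrameLevel`).
[cite: KlainermanSzeftel2023, (9.5.10), HAL p.639 L60 – p.640 L27; KlainermanSzeftel2021, l.24902–24946] -/
def step19Level (kl : ℕ) : ℕ := kl + 8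

/-- Step 20', (9.5.11): `sup_{S' ⊂ {u'=1}} (‖𝔡'^{≤k} f‖_{L²(S')} + r⁻¹‖𝔡'^{≤k} log λ‖_{L²(S')}) ≲ ε₀`, "for all `k ≤ k_large + 8`", by integrating
the PT transport equations of Cor 2.8.8, `∇_{λ⁻¹e_4'}(q̄F) = E_4(f, Γ)`, `λ⁻¹∇'_4(log λ) = 2f·ζ + E_2(f, Γ)` — no derivative of a coefficient on the
right-hand sides.  (The sentence introducing `(f, f̲, λ)` says "to the outgoing PG frame of `(ext)ℳ`" where the step concerns the outgoing PT
frame of `(ext)ℳ` named in its first sentence — a wording slip in both texts, without effect on any index.) [cite: KlainermanSzeftel2023, (9.5.11),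
HAL p.640 L28 – p.641 L23; KlainermanSzeftel2021, l.24949–24975] -/
def step20Level (kl : ℕ) : ℕ := kl + 8

/-- Step 21', (9.5.12): `sup_{S' ⊂ {u'=1}} r⁻¹‖𝔡^{≤k}(J'^{(0)} − J^{(0)})‖_{L²(S')} ≲ ε₀`, "for all `k ≤ k_large + 8`".
[cite: KlainermanSzeftel2023, (9.5.12), HAL p.641 L24–47; KlainermanSzeftel2021, l.24976–24987] -/
def jZeroLevel (kl : ℕ) : ℕ := kl + 8

/-- Step 21', (9.5.13): `sup_{S' ⊂ {u'=1}} r^{5/2+δ_B}‖𝔡^{≤k}A'‖_{L²(S')} ≲ ε₀`, "since `k ≤ k_large + 8`" — "the transformation formula for `A'` does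
not depend on `f̲`" (and curvature transforms without derivatives of the coefficients: `InitializationLedger.curvatureCost = 0`).
[cite: KlainermanSzeftel2023, (9.5.13), HAL p.641 L48 – p.642 L8; KlainermanSzeftel2021, l.24989–24992] -/
def aPrimeLevel (kl : ℕ) : ℕ := kl + 8

/-- Step 21', (9.5.14): `trX̌', X̂'` on `S'_1` "for all `k ≤ k_large + 7`" from "the control of `(f, f̲, λ)` on `S'_1` derived in Step 19'
[`k_large + 8`] … and the change of frame formulas" (`λ⁻¹tr X' − tr X = r'⁻¹𝔡'f + Γ·f + …`, a FIRST derivative of `f`), then propagated: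
`sup_{S' ⊂ {u'=1}} r(‖𝔡^{≤k}trX̌'‖ + ‖𝔡^{≤k}X̂'‖) ≲ ε₀, k ≤ k_large + 7`. [cite: KlainermanSzeftel2023, (9.5.14), HAL p.642 L9–40, L74–80;
KlainermanSzeftel2021, l.24993–25000, l.25015–25019] -/
def trXLevel (kl : ℕ) : ℕ := kl + 7

/-- Step 21', (9.5.15): `sup_{S' ⊂ {u'=1}} r⁻¹‖𝔡^{≤k}(r'/r − 1)‖_{L²(S')} ≲ ε₀ + ε₀ sup r⁻¹‖𝔡^{≤k} f̲‖`, "for all `k ≤ k_large + 7`" (from `trX̌'`).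
[cite: KlainermanSzeftel2023, (9.5.15), HAL p.642 L41–95; KlainermanSzeftel2021, `eq:estimateform(r-r')-Step21'`, l.25003–25024] -/
def rRatioLevel (kl : ℕ) : ℕ := kl + 7

/-- Step 21', (9.5.16): `sup_{S' ⊂ {u'=1}} ‖𝔡^{≤k}(𝔍' − 𝔍)‖_{L²(S')} ≲ ε₀ + ε₀ sup r⁻¹‖𝔡^{≤k} f̲‖`, "for all `k ≤ k_large + 7`" (datum on `S'_1` at
`k_large + 7`, transport `∇_4'(q'𝔍' − q𝔍)` at `k ≤ k_large + 8`, integration "for all `k ≤ k_large + 7`").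
[cite: KlainermanSzeftel2023, (9.5.16), HAL p.643 L2 – p.644 L16; KlainermanSzeftel2021, `eq:EstimateforJk-Jk'.Step21'`, l.25028–25073] -/
def jkLevel (kl : ℕ) : ℕ := kl + 7

/-- Step 22', (9.5.17): `f̲` by the last equation of Cor 2.8.8, `∇_{λ⁻¹e_4'}F̲ = −2(a q̄'/|q'|² 𝔍' − a q̄/|q|² 𝔍) + 2Ž − ½ tr X̄ F − F·χ̲̂ + E_6(f, f̲, Γ)`
(sources: `r' − r`, `J'^{(0)} − J^{(0)}`, `𝔍' − 𝔍` of Step 21'; no derivative of a coefficient), "for all `k ≤ k_large + 7`",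
`sup_{S' ⊂ {u'=1}} r⁻¹‖𝔡^{≤k} f̲‖_{L²(S')} ≲ ε₀`, and "we have finally obtained, for all `k ≤ k_large + 7`" (9.5.17) for `(f, log λ, f̲)`.
[cite: KlainermanSzeftel2023, (9.5.17), HAL p.644 L17–77; KlainermanSzeftel2021, `eq:Step23'.1`, l.25076–25105] -/
def fbLevel (kl : ℕ) : ℕ := kl + 7

/-- Step 22', (9.5.17) + (9.5.18): everything on `{u' = 1}` — `(f, log λ, f̲)` and `(r'/r − 1, 𝔍' − 𝔍)` — "for all `k ≤ k_large + 7`".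
[cite: KlainermanSzeftel2023, (9.5.17)–(9.5.18), HAL p.644 L64 – p.645 L15; KlainermanSzeftel2021, `eq:Step23'.1`–`eq:Step23'.2`, l.25101–25111] -/
def extFinalLevel (kl : ℕ) : ℕ := kl + 7

/-- Step 23': `(f', log λ', f̲')` (ingoing PG frame of `(int)L₀` → ingoing PT frame of `(int)ℳ'`) on `{r' = r₀} ∩ {u̲' = 1}` from "the estimates of
Step 22' on `{u' = 1}`", "for all `k ≤ k_large + 7`". [cite: KlainermanSzeftel2023, HAL p.645 L16–31; KlainermanSzeftel2021, l.25115–25130] -/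
def intBoundaryLevel (kl : ℕ) : ℕ := kl + 7

/-- Step 23', (9.5.19): `sup_{S' ⊂ {u̲'=1}} ‖𝔡^{≤k}(f', f̲', log λ')‖_{L²(S')} ≲ ε₀, k ≤ k_large + 7` — all THREE coefficients at the same index
(`f̲', λ'` "as in Step 20', exchanging the role of `e_3` and `e_4`"; `r' − r` by the transport equation `e_3'(r' − r) = −(λ' − 1) + f̲'·∇r + ¼|f̲'|²e_4(r)`,
no derivative of a coefficient; "`𝔍' − 𝔍` similarly to Step 21'"; "`f'` similarly to Step 22'"). [cite: KlainermanSzeftel2023, (9.5.19),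
HAL p.645 L32 – p.646 L9; KlainermanSzeftel2021, l.25133–25141] -/
def intLevelPT (kl : ℕ) : ℕ := kl + 7

/-- Step 23', (9.5.20): `sup_{S' ⊂ {u̲'=1}} ‖𝔡^{≤j+1}(J'^{(0)} − J^{(0)}, r' − r, 𝔍' − 𝔍)‖_{L²(S')} ≲ ε₀, k ≤ k_large + 7` — the QUANTIFIED bound
`k_large + 7` of the display (its derivative index is printed `j + 1` against the quantifier `k ≤ k_large + 7`, in both texts; the two
readings are `step23ReadingA`/`step23ReadingB` below). [cite: KlainermanSzeftel2023, (9.5.20), HAL p.646 L10–18; KlainermanSzeftel2021, l.25142–25145] -/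
def intDiffBound (kl : ℕ) : ℕ := kl + 7

/-- READING A of (9.5.20): `𝔡^{≤k}`, `k ≤ k_large + 7` (the index `j + 1` read as the quantified `k`). A reading, not a printed integer. [folklore] -/
def step23ReadingA (kl : ℕ) : ℕ := kl + 7

/-- READING B of (9.5.20): `𝔡^{≤j+1}` with `j ≤ k_large + 7`, i.e. order `k_large + 8`. A reading, not a printed integer. [folklore] -/
def step23ReadingB (kl : ℕ) : ℕ := kl + 8

/-- Step 23', footnote 19: the transport equation for `e_3'(r' − r)` "could not have [been] used … in `(ext)L₀` in view of the lack of decay in `r`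
for `λ − 1` … This is in fact crucial: proceeding as in Step 21' would only lead to the control [of] `k_large + 6` derivatives of `r' − r`, and
hence to a loss of at least one derivatives in Theorem 9.4.12." [cite: KlainermanSzeftel2023, HAL p.645 fn 19, L47–54; KlainermanSzeftel2021,
l.25133 (footnote)] -/
def fn19Level (kl : ℕ) : ℕ := kl + 6

/-- Step 24': "it remains to control `k ≤ k_{karge} + 7` [sic, both texts] derivatives, with suitable r-weights and `O(ε₀)` smallness
constant, of `A, B, P̌, B̲, A̲` in `{u' = 1} ∪ {u̲' = 1}`. This follows from: the control of `(f, f̲, λ)` … Step 22', … `(f', f̲', λ')` …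
Step 23', … the change of frame formulas for the curvature components, … [for `P̌`] the control of `J'^{(0)} − J^{(0)}` in Step 21' and 23',
and the control of `r' − r` in Steps 22' and 23'". [cite: KlainermanSzeftel2023, HAL p.646 L19–38; KlainermanSzeftel2021, l.25148–25167] -/
def step24Level (kl : ℕ) : ℕ := kl + 7

/-- Target of Theorem M0-PT = Thm 9.4.12, (9.4.22): `(PT)𝓘_k ≲ ε₀, k ≤ k_large + 7` (= the index of `Bootstrap.ThmM0PT` / `MainPT`).
[cite: KlainermanSzeftel2023, Thm 9.4.12 (9.4.22), HAL p.623 L25–32; KlainermanSzeftel2021, Thm M0-PT, l.24330–24342] -/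
def targetM0PT (kl : ℕ) : ℕ := kl + 7

/-- Unfolding lemma. [folklore] -/
@[simp] lemma localBALevel_def (kl : ℕ) : localBALevel kl = kl + 7 := rfl
/-- Unfolding lemma. [folklore] -/
@[simp] lemma s1Level_def (kl : ℕ) : s1Level kl = kl + 8 := rfl
/-- Unfolding lemma. [folklore] -/
@[simp] lemma baPTSigmaStar_def (kl : ℕ) : baPTSigmaStar kl = kl + 7 := rfl
/-- Unfolding lemma. [folklore] -/
@[simp] lemma traceCost_def : traceCost = 1 := rfl
/-- Unfolding lemma. [folklore] -/
@[simp] lemma step17SphereLevel_def (kl : ℕ) : step17SphereLevel kl = kl + 6 := rfl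
/-- Unfolding lemma. [folklore] -/
@[simp] lemma step17NablaFLevel_def (kl : ℕ) : step17NablaFLevel kl = kl + 7 := rfl
/-- Unfolding lemma. [folklore] -/
@[simp] lemma step17FpLevel_def (kl : ℕ) : step17FpLevel kl = kl + 8 := rfl
/-- Unfolding lemma. [folklore] -/
@[simp] lemma step19Level_def (kl : ℕ) : step19Level kl = kl + 8 := rfl
/-- Unfolding lemma. [folklore] -/
@[simp] lemma step20Level_def (kl : ℕ) : step20Level kl = kl + 8 := rfl
/-- Unfolding lemma. [folklore] -/
@[simp] lemma jZeroLevel_def (kl : ℕ) : jZeroLevel kl = kl + 8 := rfl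
/-- Unfolding lemma. [folklore] -/
@[simp] lemma aPrimeLevel_def (kl : ℕ) : aPrimeLevel kl = kl + 8 := rfl
/-- Unfolding lemma. [folklore] -/
@[simp] lemma trXLevel_def (kl : ℕ) : trXLevel kl = kl + 7 := rfl
/-- Unfolding lemma. [folklore] -/
@[simp] lemma rRatioLevel_def (kl : ℕ) : rRatioLevel kl = kl + 7 := rfl
/-- Unfolding lemma. [folklore] -/
@[simp] lemma jkLevel_def (kl : ℕ) : jkLevel kl = kl + 7 := rfl
/-- Unfolding lemma. [folklore] -/
@[simp] lemma fbLevel_def (kl : ℕ) : fbLevel kl = kl + 7 := rfl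
/-- Unfolding lemma. [folklore] -/
@[simp] lemma extFinalLevel_def (kl : ℕ) : extFinalLevel kl = kl + 7 := rfl
/-- Unfolding lemma. [folklore] -/
@[simp] lemma intBoundaryLevel_def (kl : ℕ) : intBoundaryLevel kl = kl + 7 := rfl
/-- Unfolding lemma. [folklore] -/
@[simp] lemma intLevelPT_def (kl : ℕ) : intLevelPT kl = kl + 7 := rfl
/-- Unfolding lemma. [folklore] -/
@[simp] lemma intDiffBound_def (kl : ℕ) : intDiffBound kl = kl + 7 := rfl
/-- Unfolding lemma. [folklore] -/
@[simp] lemma step23ReadingA_def (kl : ℕ) : step23ReadingA kl = kl + 7 := rfl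
/-- Unfolding lemma. [folklore] -/
@[simp] lemma step23ReadingB_def (kl : ℕ) : step23ReadingB kl = kl + 8 := rfl
/-- Unfolding lemma. [folklore] -/
@[simp] lemma fn19Level_def (kl : ℕ) : fn19Level kl = kl + 6 := rfl
/-- Unfolding lemma. [folklore] -/
@[simp] lemma step24Level_def (kl : ℕ) : step24Level kl = kl + 7 := rfl
/-- Unfolding lemma. [folklore] -/
@[simp] lemma targetM0PT_def (kl : ℕ) : targetM0PT kl = kl + 7 := rfl

/-! ### §1.1 Step 17': from BA-PT on `Σ_*` to the sphere `S'_1`, one above the local bootstrap -/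

/-- **Step 17' closes one above its bootstrap assumption**: BA-PT in `L²(Σ_*)` at `k_large + 7`, minus the printed trace cost 1, gives the spheres
`S_*` at `k_large + 6`; the displayed elliptic passage (`φ ∈ 𝔥_{k+2}`, `r'∇f_0' − J'^{(0)}∈ ∈ 𝔥_{k+1}`) puts the first-derivative quantities at
`k_large + 7`, and `f_p' − f_p ∈ 𝔥_{k+1}(S'_1)` puts (9.5.9) at `k_large + 8` = the level of (9.5.5) = the local assumptions (9.5.3)/(9.5.4) plus one
("improves … [in] regularity"). [cite: KlainermanSzeftel2023, HAL p.636–639] -/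
theorem step17_chain (kl : ℕ) :
    baPTSigmaStar kl - traceCost = step17SphereLevel kl ∧ step17NablaFLevel kl = step17SphereLevel kl + 1 ∧
    step17FpLevel kl = step17NablaFLevel kl + 1 ∧ step17FpLevel kl = s1Level kl ∧ step17FpLevel kl = localBALevel kl + 1 ∧
    s1Level kl = localBALevel kl + 1 := by
  dsimp only [baPTSigmaStar_def, traceCost_def, step17SphereLevel_def, step17NablaFLevel_def, step17FpLevel_def, s1Level_def,
    localBALevel_def]
  omega

/-- The primed GCM sphere is the unprimed one shifted by `InitializationLedger.primedShift = 7`, and the local bootstrap (9.5.3) is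
`InitializationLedger.smaxM0` shifted by 7 (Remark 9.5.2). [cite: KlainermanSzeftel2023, Rem 9.5.2, HAL p.636 L43–46] -/
theorem primed_levels_are_shifted (kl : ℕ) :
    s1Level kl = InitializationLedger.gcmSphereLevel (kl + InitializationLedger.primedShift) ∧
    localBALevel kl = InitializationLedger.smaxM0 (kl + InitializationLedger.primedShift) ∧
    localBALevel kl - InitializationLedger.smaxM0 kl = InitializationLedger.primedShift := by
  dsimp only [s1Level_def, InitializationLedger.gcmSphereLevel_def, InitializationLedger.primedShift_def, localBALevel_def,
    InitializationLedger.smaxM0_def]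
  omega

/-! ### §1.2 Steps 19'–22' on `{u' = 1}`: the only derivative spent is the frame-to-Ricci passage at `trX̌'` -/

/-- **The `(ext)` chain of Theorem M0-PT**: `(f, log λ)` are carried at the sphere level `k_large + 8` ((9.5.10), (9.5.11): the PT transport
equations cost nothing), as are `J'^{(0)} − J^{(0)}` ((9.5.12)) and `A'` ((9.5.13), curvature: `curvatureCost = 0`); `trX̌'` comes from `𝔡'f`
on `S'_1`, ONE below ((9.5.14): `frameToRicciCost = 1`), and `r'/r − 1`, `𝔍' − 𝔍`, `f̲` inherit `k_large + 7` ((9.5.15)–(9.5.17)); the closing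
display (9.5.17)/(9.5.18) is the minimum. [cite: KlainermanSzeftel2023, (9.5.10)–(9.5.18), HAL p.640–645] -/
theorem m0pt_ext_chain (kl : ℕ) :
    step19Level kl = s1Level kl ∧ step20Level kl = step19Level kl ∧ jZeroLevel kl = step20Level kl ∧
    aPrimeLevel kl = step20Level kl - InitializationLedger.curvatureCost ∧
    trXLevel kl = step19Level kl - InitializationLedger.frameToRicciCost ∧ rRatioLevel kl = trXLevel kl ∧ jkLevel kl = trXLevel kl ∧
    fbLevel kl = min (rRatioLevel kl) (jkLevel kl) ∧ extFinalLevel kl = min (step20Level kl) (fbLevel kl) := by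
  dsimp only [step19Level_def, s1Level_def, step20Level_def, jZeroLevel_def, aPrimeLevel_def, InitializationLedger.curvatureCost_def,
    trXLevel_def, InitializationLedger.frameToRicciCost_def, rRatioLevel_def, jkLevel_def, fbLevel_def, extFinalLevel_def]
  omega

/-! ### §1.3 Steps 23'–24': `(int)` inherits `k_large + 7` with no further loss; the chain closes with slack ZERO -/

/-- **The `(int)` chain and the conclusion**: the boundary data on `{r' = r₀} ∩ {u̲' = 1}` are Step 22''s ((9.5.17)), all three coefficients stay at
`k_large + 7` ((9.5.19)), the differences are bounded at `k_large + 7` ((9.5.20)), and Step 24' asks exactly `k_large + 7` of the curvature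
components, which the change-of-frame formulas deliver at the coefficients' own level (`curvatureCost = 0`) — the target (9.4.22).
[cite: KlainermanSzeftel2023, (9.5.19)–(9.5.20), Step 24', HAL p.645–646; Thm 9.4.12, p.623] -/
theorem m0pt_int_chain_and_close (kl : ℕ) :
    intBoundaryLevel kl = extFinalLevel kl ∧ intLevelPT kl = intBoundaryLevel kl ∧ intDiffBound kl = intLevelPT kl ∧
    step24Level kl = min (extFinalLevel kl) (intLevelPT kl) - InitializationLedger.curvatureCost ∧ step24Level kl = targetM0PT kl ∧
    targetM0PT kl - step24Level kl = 0 := by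
  dsimp only [intBoundaryLevel_def, extFinalLevel_def, intLevelPT_def, intDiffBound_def, step24Level_def,
    InitializationLedger.curvatureCost_def, targetM0PT_def]
  omega

/-- **Theorem M0-PT spends no derivative beyond Proposition 8.2.7's three**: from the data index `k_large + 10` (`GCMHRungLedger.dataIndex`,
hypothesis `𝓘_{k_large+10} ≤ ε₀` of Thm 9.4.12) to the target `k_large + 7` the total loss is `GCMHRungLedger.prop827Loss = 3`; inside §9.5 the GCM
sphere sits ONE above the target and that one derivative is the frame-to-Ricci passage at `trX̌'` (binding members: `trX̌'`, `r'/r − 1`, `𝔍' − 𝔍`,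
`f̲`, all of `(int)`); slack 0. [cite: KlainermanSzeftel2023, Thm 9.4.12 HAL p.623, (9.5.5) p.636, (9.5.14)–(9.5.19) p.642–646] -/
theorem m0pt_total_loss (kl : ℕ) :
    GCMHRungLedger.dataIndex kl - targetM0PT kl = GCMHRungLedger.prop827Loss ∧
    s1Level kl - targetM0PT kl = InitializationLedger.frameToRicciCost ∧
    trXLevel kl = targetM0PT kl ∧ fbLevel kl = targetM0PT kl ∧ intLevelPT kl = targetM0PT kl ∧
    step20Level kl = targetM0PT kl + 1 ∧ jZeroLevel kl = targetM0PT kl + 1 ∧ aPrimeLevel kl = targetM0PT kl + 1 := by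
  dsimp only [GCMHRungLedger.dataIndex_def, targetM0PT_def, GCMHRungLedger.prop827Loss_def, s1Level_def,
    InitializationLedger.frameToRicciCost_def, trXLevel_def, fbLevel_def, intLevelPT_def, step20Level_def, jZeroLevel_def, aPrimeLevel_def]
  omega

/-- **Footnote 19's counterfactual, counted**: obtaining `r' − r` on `(int)L₀` "as in Step 21'" — from `trX̲̌'`, i.e. from a FIRST derivative of the
coefficients of (9.5.19) (`frameToRicciCost = 1`) — gives the printed `k_large + 6`, one BELOW what Step 24' consumes: "a loss of at least one
derivative in Theorem 9.4.12".  The transport equation `e_3'(r' − r) = −(λ' − 1) + …` used instead keeps `k_large + 7`.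
[cite: KlainermanSzeftel2023, HAL p.645 fn 19; KlainermanSzeftel2021, l.25133] -/
theorem fn19_counterfactual (kl : ℕ) :
    intLevelPT kl - InitializationLedger.frameToRicciCost = fn19Level kl ∧ fn19Level kl + 1 = step24Level kl ∧
    fn19Level kl < targetM0PT kl ∧ intLevelPT kl = step24Level kl := by
  dsimp only [intLevelPT_def, InitializationLedger.frameToRicciCost_def, fn19Level_def, step24Level_def, targetM0PT_def]
  omega

/-! ### §1.4 The display (9.5.20): both readings, neither carrying load -/

/-- **(9.5.20) under its two readings**: reading A (`𝔡^{≤k}`, `k ≤ k_large + 7`) is exactly what Step 24' consumes (the differences enter `P̌`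
through `q' = r' + iaJ'^{(0)}` without derivatives) and what (9.5.19) plus the displayed transport of `e_3'(r' − r)` supply; reading B
(`𝔡^{≤j+1}`, `j ≤ k_large + 7`, order `k_large + 8`) coincides with the `(ext)` level (9.5.12) of `J'^{(0)} − J^{(0)}` but exceeds by ONE the
level `k_large + 7` at which `r' − r` is supplied on `(int)` from `(λ' − 1, f̲')`; nothing downstream reads order `k_large + 8`.  This is
arithmetic on the two readings; which one the authors intend is not decided here. [cite: KlainermanSzeftel2023, (9.5.20), HAL p.646 L10–18,
Step 24' L30–36, (9.5.12) p.641, (9.5.19) p.646] -/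
theorem step23_display_readings (kl : ℕ) :
    step23ReadingA kl = intDiffBound kl ∧ step23ReadingA kl = step24Level kl + InitializationLedger.curvatureCost ∧
    step23ReadingA kl = intLevelPT kl ∧ step23ReadingB kl = jZeroLevel kl ∧ step23ReadingB kl = intLevelPT kl + 1 ∧
    step24Level kl ≤ step23ReadingA kl ∧ step23ReadingA kl < step23ReadingB kl := by
  dsimp only [step23ReadingA_def, intDiffBound_def, step24Level_def, InitializationLedger.curvatureCost_def, intLevelPT_def,
    step23ReadingB_def, jZeroLevel_def]
  omega

/-! ## §2 Theorem 9.4.10 and Theorem M8 ([J] §9.4.3 Steps 1–6): the printed levels -/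

/-- Theorem 9.4.10, (9.4.14): `𝔖_k + ℜ_k ≲ ε₀, k ≤ k_large + 7` — the control of the PT frames of `ℳ` in the (L²-based) global norms of §9.4.1;
the same index as BA-PT (9.4.21) and as Thm 9.4.12 (9.4.22). [cite: KlainermanSzeftel2023, Thm 9.4.10 (9.4.14), HAL p.615 – p.616 L4;
KlainermanSzeftel2021, `theorem:Main-PT`, l.24053–24064] -/
def ptLevel (kl : ℕ) : ℕ := kl + 7

/-- The iteration behind Thm 9.4.10 runs over `k_small − 1 ≤ J ≤ k_large + 6` (Thm 9.4.15, Props 9.4.16–9.4.19, Cor 9.4.20; (9.4.47),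
(9.4.48) at `J = k_large + 6`), and §9.4.7 Step 4 then passes "from `p = k_large + 6` to `p = k_large + 7`" to reach
`ℜ_{k_large+7} + 𝔖_{k_large+7} ≲ ε₀`. [cite: KlainermanSzeftel2023, Thm 9.4.15 HAL p.627 L13, (9.4.47)–(9.4.48) p.630 L22–25, p.632 L22,
p.633 L41 – p.635 L26; KlainermanSzeftel2021, l.24483, l.24628–24630, l.24698–24745] -/
def iterTop (kl : ℕ) : ℕ := kl + 6

/-- Step 2, (9.4.16): `‖𝔡^{≤k_large+7}ℋ̌'‖_{L²(Σ_*)} ≲ ε₀` — the PG-frame `ℋ̌'` on `Σ_*`, "as this quantity is part of the boundedness norm for the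
outgoing PG frame of `(ext)ℳ`, see (3.3.13)" (there at order `k`: `(ext)𝔅_k ∋ (∫_{Σ_*}|𝔡^{≤k}ℋ̌|²)^{1/2}`). [cite: KlainermanSzeftel2023, (9.4.16),
HAL p.617 L2–37, (3.3.13) p.136; KlainermanSzeftel2021, l.24105–24129, `equation:defboudednessnormsMext:chap3` l.5811–5816] -/
def step2HLevel (kl : ℕ) : ℕ := kl + 7

/-- Step 3, (9.4.17): "The remaining estimates for the PG frames of `ℳ` being all in sup norm, we first derive sup norms estimates for the PT
frames of `ℳ`. In view of the control of the PT frames provided by Theorem 9.4.10, together with Sobolev and the trace theorem, we obtain, for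
`k ≤ k_large + 4`," the weighted sup norms of `(Γ_g, Γ_b, A, B)` on `(ext)ℳ`, `(top)ℳ'`, `(int)ℳ'` (Remark 9.4.11: a priori with weaker
r-powers for `trX̲̌`, `Ξ̌`, "for `k ≤ k_large + 4`"). [cite: KlainermanSzeftel2023, (9.4.17), HAL p.617 L39–69, Rem 9.4.11 p.618 L2–21;
KlainermanSzeftel2021, `eq:applicationofSobolevtothePTframeinproofThmM8`, l.24131–24147] -/
def step3SupLevel (kl : ℕ) : ℕ := kl + 4

/-- The loss Step 3 prints between (9.4.14) (`k_large + 7`, L²-based) and (9.4.17) (`k_large + 4`, sup): THREE derivatives, attributed in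
words to "Sobolev and the trace theorem". [cite: KlainermanSzeftel2023, (9.4.14) HAL p.616 L4 vs (9.4.17) p.617 L41–42] -/
def step3Loss : ℕ := 3

/-- Step 3, (9.4.18): the improved bound `|𝔡^{≤k_large+4}Ž| ≲ ε₀/r_*² + ε₀/r^{5/2}` on `(ext)ℳ` — same index `k_large + 4` (transport of
`∇_4Ž + q⁻¹Ž = …` from `Σ_*`). [cite: KlainermanSzeftel2023, (9.4.18), HAL p.618 L22–46; KlainermanSzeftel2021, l.24149–24160] -/
def zImprovedLevel (kl : ℕ) : ℕ := kl + 4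

/-- Step 4, (9.4.19): `sup_{(ext)ℳ} r|𝔡^{≤k_large+4} f̲| ≲ ε₀` — the only non-trivial coefficient of the change PT → PG on `(ext)ℳ` (`f = 0`,
`λ = 1`, Step 1), from `sup_{Σ_*} r|𝔡^{≤k_large+4} f̲| ≲ ε₀` and the transport equation `∇_4F̲ + ½tr X F̲ = −2Ž − F̲·χ̂` (no derivative of `f̲` on
the right): no loss. [cite: KlainermanSzeftel2023, (9.4.19), HAL p.618 L47 – p.619 L28, Step 1 p.616 L8–47; KlainermanSzeftel2021, l.24163–24186,
l.24078–24103] -/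
def step4FbLevel (kl : ℕ) : ℕ := kl + 4

/-- Step 5: `sup_{{u=u_*}} r|𝔡^{≤k_large+4}(f', f̲', log λ')| ≲ ε₀` — the coefficients of the change ingoing PT frame of `(top)ℳ'` → ingoing PG frame
of `(top)ℳ` on the boundary `{u = u_*} = (top)ℳ ∩ (ext)ℳ`. [cite: KlainermanSzeftel2023, HAL p.619 L29–51; KlainermanSzeftel2021, l.24188–24206] -/
def step5BoundaryLevel (kl : ℕ) : ℕ := kl + 4

/-- Step 5: `sup_{(top)ℳ} r|𝔡^{≤k_large+4}(f̲', log λ')| ≲ ε₀`, from the ingoing analog of Cor 2.2.5: `∇_{λ'⁻¹e_3'}F̲' + ½tr X̲̄ F̲' = −χ̲̂·F̲' +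
E̲_1(f̲', Γ)`, `λ'⁻¹∇_3'(log λ') = f̲'·(−ζ − η) + E̲_2(f̲', Γ)` — no derivative of a coefficient on the right: no loss.
[cite: KlainermanSzeftel2023, HAL p.620 L2–19; KlainermanSzeftel2021, l.24208–24216] -/
def step5FbLaLevel (kl : ℕ) : ℕ := kl + 4

/-- Step 5: `sup_{(top)ℳ} r|𝔡^{≤k_large+3} f'| ≲ ε₀`, from `∇_{λ'⁻¹e_3'}F' + ½tr X̲ F' = −2Ž + 2𝒟'(log λ') + 2ωF' + E_3(∇'^{≤1}f̲', f', Γ, λ'⁻¹χ̲')`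
— FIRST derivatives of `(f̲', log λ')` on the right: `f'` lands one below them. [cite: KlainermanSzeftel2023, HAL p.620 L20–39;
KlainermanSzeftel2021, l.24218–24229] -/
def step5FLevel (kl : ℕ) : ℕ := kl + 3

/-- The derivative loss of the PG transport system (Cor 2.2.5: the equation for the third coefficient carries `2𝒟'(log λ)` and
`E_3(∇'^{≤1}f, f̲, Γ, λ⁻¹χ̲')`), NAMED in print: Remark 2.8.9 "the transport equation for `F̲` in Corollary 2.8.8 [PT] is at the same regularity
level that the one for `F` and `λ`, while the one for `F̲` in Corollary 2.2.5 [PG] loses one derivative. This is another manifestation of the fact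
that, unlike the PT frame, the PG frame exhibits a loss of derivative"; footnote 14 (proof of Lemma 9.4.13): the PT transport equations "do
not lose derivatives [— u]nlike their analogs for PG structures in Corollary 2.2.5".  Displayed instances of the loss: §9.4.3 Step 5/6
(`k_large + 4 ↦ k_large + 3`), §8.3 Step 23 (8.3.68) and §8.4 (8.4.28)/(8.4.31) (`k ↦ k − 1`; `InitializationLedger.m0_chain_steps`).
[cite: KlainermanSzeftel2023, Rem 2.8.9 HAL p.113 L62–66, Cor 2.2.5 p.67 L38–50, fn 14 p.625 L40–43/L66, p.620 L18–39; KlainermanSzeftel2021,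
l.4816, l.2494–2530, l.24402, l.24215–24228] -/
def pgTransportLoss : ℕ := 1

/-- Step 6: `sup_{(int)ℳ}(|𝔡^{≤k_large+4}(f̲'', log λ'')| + |𝔡^{≤k_large+3} f''|) ≲ ε₀` — the lossy `f''` of the change ingoing PT frame of `(int)ℳ'`
→ ingoing PG frame of `(int)ℳ` ("arguing as in Step 5"); the companion index `k_large + 4` is `InitializationLedger.m8IntDisplayLevel`.
[cite: KlainermanSzeftel2023, HAL p.620 L40–48; KlainermanSzeftel2021, l.24232–24235] -/
def step6IntFLevel (kl : ℕ) : ℕ := kl + 3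

/-- Step 6: the coordinate differences `(r' − r, cos θ' − cos θ, q' − q, 𝔍' − 𝔍)` on `(top)ℳ`/`(int)ℳ` at `𝔡^{≤k_large+3}` (= `k + 1` at
`k = k_large + 2`), by the transport equations `e_3'(r' − r), …` from `(ext)ℳ`, where they vanish identically (Step 1: `r' = r, θ' = θ, q' = q,
𝔍' = 𝔍`). [cite: KlainermanSzeftel2023, HAL p.621 L9 – p.622 L72; KlainermanSzeftel2021, l.24252–24294] -/
def step6CoordLevel (kl : ℕ) : ℕ := kl + 3

/-- The STATEMENT of Theorem M8: "The GCM admissible spacetime exhibited in Theorem M7 satisfies in addition `𝔑^{(Sup)}_{k_large} ≲ ε₀` and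
therefore belongs to `ℵ(u_*')`" — index `k_large`; its PROOF ends with `𝔑^{(Sup)}_{k_large+2} ≲ ε₀` "as desired. This concludes the proof of
Theorem M8" (`InitializationLedger.m8SupNormLevel = k_large + 2`). [cite: KlainermanSzeftel2023, Thm M8, HAL p.160 L2–7, p.622 L73–76;
KlainermanSzeftel2021, `thmM8` l.6803–6808, l.24295–24299] -/
def targetM8 (kl : ℕ) : ℕ := kl

/-- Theorem M8's end slack: the proved index minus the stated one. A derived count, not a printed integer. [folklore] -/
def m8Slack (kl : ℕ) : ℕ := InitializationLedger.m8SupNormLevel kl - targetM8 kl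

/-- Unfolding lemma. [folklore] -/
@[simp] lemma ptLevel_def (kl : ℕ) : ptLevel kl = kl + 7 := rfl
/-- Unfolding lemma. [folklore] -/
@[simp] lemma iterTop_def (kl : ℕ) : iterTop kl = kl + 6 := rfl
/-- Unfolding lemma. [folklore] -/
@[simp] lemma step2HLevel_def (kl : ℕ) : step2HLevel kl = kl + 7 := rfl
/-- Unfolding lemma. [folklore] -/
@[simp] lemma step3SupLevel_def (kl : ℕ) : step3SupLevel kl = kl + 4 := rfl
/-- Unfolding lemma. [folklore] -/
@[simp] lemma step3Loss_def : step3Loss = 3 := rfl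
/-- Unfolding lemma. [folklore] -/
@[simp] lemma zImprovedLevel_def (kl : ℕ) : zImprovedLevel kl = kl + 4 := rfl
/-- Unfolding lemma. [folklore] -/
@[simp] lemma step4FbLevel_def (kl : ℕ) : step4FbLevel kl = kl + 4 := rfl
/-- Unfolding lemma. [folklore] -/
@[simp] lemma step5BoundaryLevel_def (kl : ℕ) : step5BoundaryLevel kl = kl + 4 := rfl
/-- Unfolding lemma. [folklore] -/
@[simp] lemma step5FbLaLevel_def (kl : ℕ) : step5FbLaLevel kl = kl + 4 := rfl
/-- Unfolding lemma. [folklore] -/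
@[simp] lemma step5FLevel_def (kl : ℕ) : step5FLevel kl = kl + 3 := rfl
/-- Unfolding lemma. [folklore] -/
@[simp] lemma pgTransportLoss_def : pgTransportLoss = 1 := rfl
/-- Unfolding lemma. [folklore] -/
@[simp] lemma step6IntFLevel_def (kl : ℕ) : step6IntFLevel kl = kl + 3 := rfl
/-- Unfolding lemma. [folklore] -/
@[simp] lemma step6CoordLevel_def (kl : ℕ) : step6CoordLevel kl = kl + 3 := rfl
/-- Unfolding lemma. [folklore] -/
@[simp] lemma targetM8_def (kl : ℕ) : targetM8 kl = kl := rfl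
/-- Unfolding lemma. [folklore] -/
@[simp] lemma m8Slack_def (kl : ℕ) : m8Slack kl = InitializationLedger.m8SupNormLevel kl - targetM8 kl := rfl

/-! ### §2.1 Theorem 9.4.10 sits one above the iteration and equals Theorem M0-PT's target -/

/-- (9.4.14) = (9.4.21) = (9.4.22) = `k_large + 7` = `iterTop + 1`: Theorem M0-PT feeds BA-PT/Thm 9.4.10 at the same index, and the
iteration of Thm 9.4.15 stops one below it. [cite: KlainermanSzeftel2023, HAL p.616 L4, p.623 L20/L31, p.627 L13, p.632 L22] -/
theorem pt_level_links (kl : ℕ) :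
    ptLevel kl = iterTop kl + 1 ∧ ptLevel kl = targetM0PT kl ∧ ptLevel kl = baPTSigmaStar kl ∧ step2HLevel kl = ptLevel kl := by
  dsimp only [ptLevel_def, iterTop_def, targetM0PT_def, baPTSigmaStar_def, step2HLevel_def]; omega

/-! ### §2.2 The chain of §9.4.3 and its itemised loss `3 + 0 + 1 + 1 = 5` -/

/-- **The printed chain of Theorem M8, link by link**: Step 3 spends 3 ("Sobolev and the trace theorem"; = the trace cost 1 printed in §9.5
Step 17' plus the Sobolev cost 2 printed at (8.4.3)→(8.4.4), `GCMHRungLedger.sobolevCost`); (9.4.18), Step 4 and the boundary/`(f̲', λ')`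
displays of Step 5 spend nothing; `f'` (and `f''`) land one below by the PG transport loss; the Ricci coefficients "for `k ≤ k_large + 2`" are
one below the lossy coefficient (`InitializationLedger.frameToRicciCost`); the coordinates are asked one above that, at `k_large + 3` = the
level of the lossy coefficient that transports them. [cite: KlainermanSzeftel2023, §9.4.3, HAL p.616–622] -/
theorem m8_chain_values (kl : ℕ) :
    step3SupLevel kl = ptLevel kl - step3Loss ∧ step3Loss = traceCost + GCMHRungLedger.sobolevCost ∧
    zImprovedLevel kl = step3SupLevel kl ∧ step4FbLevel kl = step3SupLevel kl ∧ step5BoundaryLevel kl = step4FbLevel kl ∧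
    step5FbLaLevel kl = step5BoundaryLevel kl ∧ step5FLevel kl = step5FbLaLevel kl - pgTransportLoss ∧
    InitializationLedger.m8IntDisplayLevel kl = step5FbLaLevel kl ∧ step6IntFLevel kl = InitializationLedger.m8IntDisplayLevel kl - pgTransportLoss ∧
    InitializationLedger.m8SupNormLevel kl = step6IntFLevel kl - InitializationLedger.frameToRicciCost ∧
    step6CoordLevel kl = InitializationLedger.m8SupNormLevel kl + 1 ∧ step6CoordLevel kl = step6IntFLevel kl := by
  dsimp only [step3SupLevel_def, ptLevel_def, step3Loss_def, traceCost_def, GCMHRungLedger.sobolevCost_def, zImprovedLevel_def,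
    step4FbLevel_def, step5BoundaryLevel_def, step5FbLaLevel_def, step5FLevel_def, pgTransportLoss_def,
    InitializationLedger.m8IntDisplayLevel_def, step6IntFLevel_def, InitializationLedger.m8SupNormLevel_def,
    InitializationLedger.frameToRicciCost_def, step6CoordLevel_def]
  omega

/-- **Itemised: from the PT level `k_large + 7` to the proved `𝔑^{(Sup)}_{k_large+2}` the proof of Theorem M8 spends `5 = 3 + 0 + 1 + 1`**
(Sobolev-and-trace, the `(ext)` coefficient `f̲`, the PG transport loss on `f'`/`f''`, the frame-to-Ricci passage).
[cite: KlainermanSzeftel2023, (9.4.14) HAL p.616, p.622 L75] -/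
theorem m8_losses_itemised (kl : ℕ) :
    ptLevel kl - InitializationLedger.m8SupNormLevel kl = 5 ∧
    step3Loss + (step3SupLevel kl - step4FbLevel kl) + pgTransportLoss + InitializationLedger.frameToRicciCost = 5 := by
  dsimp only [ptLevel_def, InitializationLedger.m8SupNormLevel_def, step3Loss_def, step3SupLevel_def, step4FbLevel_def, pgTransportLoss_def,
    InitializationLedger.frameToRicciCost_def]
  omega

/-! ### §2.3 Theorem M8 closes with slack TWO -/

/-- **Theorem M8's printed budget closes with two derivatives to spare**: the proof delivers `𝔑^{(Sup)}_{k_large+2}`, the statement asks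
`𝔑^{(Sup)}_{k_large}`; and the `Σ_*`-member `ℋ̌'` of `(ext)𝔅_k` is supplied at `k_large + 7`, five above the proved index.
[cite: KlainermanSzeftel2023, Thm M8 HAL p.160 L2–7 vs p.622 L73–76, (9.4.16) p.617 L37] -/
theorem m8_closes_with_slack_two (kl : ℕ) :
    targetM8 kl ≤ InitializationLedger.m8SupNormLevel kl ∧ m8Slack kl = 2 ∧ InitializationLedger.m8SupNormLevel kl = targetM8 kl + 2 ∧
    step2HLevel kl - InitializationLedger.m8SupNormLevel kl = 5 := by
  dsimp only [targetM8_def, InitializationLedger.m8SupNormLevel_def, m8Slack_def, step2HLevel_def]; omega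

/-! ## §3 Synthesis: Theorem M0-PT against Theorem M0, and the end slacks of the five printed budgets -/

/-- **Footnote 13's gap, itemised on printed levels**: "the conclusions of Theorem M0 hold for `k ≤ k_large − 2` while the ones of Theorem M0-PT
hold for `k ≤ k_large + 7`" — a gap of NINE = `primedShift` 7 (the local bootstrap / `s_max` at `k_large + 7` instead of `k_large`, Remark 9.5.2)
+ 1 on `(ext)` (Theorem M0 descends TWO from its GCM sphere `𝔥_{k_large+1}(S'_1)` to `f̲` at `k_large − 1`, (8.3.33)→(8.3.66), passing to sup
norms on the way; Theorem M0-PT descends ONE, (9.5.5)→(9.5.17), "we now rely on L² norms rather than sup norms") + 1 on `(int)` (Theorem M0: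
`(r' − r, f')` one below `(f̲', λ')`, (8.3.68), the PG transport loss; Theorem M0-PT: all of (9.5.19) at one index, "these transport equations do
not lose derivatives"). [cite: KlainermanSzeftel2023, fn 13 HAL p.623 L35–36, Rem 9.5.2 p.636, Step 17' p.637 L19, fn 14 p.625, Rem 2.8.9 p.113;
KlainermanSzeftel2021, l.24328, l.24798–24800, l.24821, l.24402, l.4816] -/
theorem m0pt_minus_m0_itemised (kl : ℕ) (hkl : 2 ≤ kl) :
    targetM0PT kl - InitializationLedger.targetM0 kl = 9 ∧
    9 = InitializationLedger.primedShift + 1 + 1 ∧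
    localBALevel kl - InitializationLedger.smaxM0 kl = InitializationLedger.primedShift ∧
    (InitializationLedger.gcmSphereLevel kl - InitializationLedger.extFbLevel kl) - (s1Level kl - fbLevel kl) = 1 ∧
    (InitializationLedger.extFbLevel kl - InitializationLedger.intRFLevel kl) - (fbLevel kl - intLevelPT kl) = 1 := by
  dsimp only [targetM0PT_def, InitializationLedger.targetM0_def, InitializationLedger.primedShift_def, localBALevel_def,
    InitializationLedger.smaxM0_def, InitializationLedger.gcmSphereLevel_def, InitializationLedger.extFbLevel_def, s1Level_def, fbLevel_def,
    InitializationLedger.intRFLevel_def, intLevelPT_def]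
  omega

/-- **Both initialization theorems spend exactly their displayed transport losses**: with the PG loss 1 and the PT loss 0 per region boundary,
Theorem M0's `(int)` branch (two PG changes after the sup passage) and Theorem M0-PT's (no loss after `trX̌'`) reproduce the printed
conclusions `k_large − 2` and `k_large + 7`. [cite: KlainermanSzeftel2023, (8.3.66)/(8.3.68) HAL p.531–532, (9.5.17)/(9.5.19) p.644–646] -/
theorem transport_losses_reproduce_targets (kl : ℕ) (hkl : 2 ≤ kl) :
    InitializationLedger.extFLaLevel kl - pgTransportLoss - pgTransportLoss - InitializationLedger.curvatureCost = InitializationLedger.targetM0 kl ∧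
    trXLevel kl - 0 - 0 - InitializationLedger.curvatureCost = targetM0PT kl := by
  dsimp only [InitializationLedger.extFLaLevel_def, pgTransportLoss_def, InitializationLedger.curvatureCost_def,
    InitializationLedger.targetM0_def, trXLevel_def, targetM0PT_def]
  omega

/-- **The end slacks of the five printed budgets of the M-chain** (each proved index minus the stated one, on the displays as printed):
Theorem M0 `(int)` branch 0 (`InitializationLedger.m0_closes`), Theorem M0-PT 0 (§1.3), Theorem M6 0 (`InitializationLedger.m6_chain_values`:
the concluding line at `k_large`), Theorem M7 8 at `k_small` (`ExtensionRegularityLedger.slack`), Theorem M8 2 at `k_large` (§2.3).  So the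
data index `k_large + 10` is bound with zero slack through M0, M0-PT and M6, and the only room printed at `k_large` downstream of BA-PT is
Theorem M8's two derivatives. [cite: KlainermanSzeftel2023, HAL p.531–532, p.550, p.592, p.622–623, p.646] -/
theorem m_chain_end_slacks (kl ks : ℕ) (hkl : 2 ≤ kl) :
    InitializationLedger.intRFLevel kl - InitializationLedger.curvatureCost - InitializationLedger.targetM0 kl = 0 ∧
    step24Level kl - targetM0PT kl = 0 ∧ targetM0PT kl - step24Level kl = 0 ∧
    InitializationLedger.finalM6 kl - InitializationLedger.targetM6 kl = 0 ∧
    ExtensionRegularityLedger.slack ks = 8 ∧ m8Slack kl = 2 := by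
  dsimp only [InitializationLedger.intRFLevel_def, InitializationLedger.curvatureCost_def, InitializationLedger.targetM0_def, step24Level_def,
    targetM0PT_def, InitializationLedger.finalM6_def, InitializationLedger.targetM6_def, ExtensionRegularityLedger.slack_def,
    ExtensionRegularityLedger.finalLevel_def, ExtensionRegularityLedger.targetLevel_def, ExtensionRegularityLedger.kStar_def, m8Slack_def,
    InitializationLedger.m8SupNormLevel_def, targetM8_def]
  omega

/-! ## §4 Numerical instances (`k_large = 20`, `k_small = 10`) -/

/-- [folklore] -/
example : s1Level 20 = 28 ∧ step17SphereLevel 20 = 26 ∧ step20Level 20 = 28 ∧ trXLevel 20 = 27 ∧ fbLevel 20 = 27 ∧ intLevelPT 20 = 27 ∧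
    fn19Level 20 = 26 ∧ targetM0PT 20 = 27 ∧ step23ReadingA 20 = 27 ∧ step23ReadingB 20 = 28 := by decide

/-- [folklore] -/
example : ptLevel 20 = 27 ∧ iterTop 20 = 26 ∧ step3SupLevel 20 = 24 ∧ step4FbLevel 20 = 24 ∧ step5FLevel 20 = 23 ∧ step6IntFLevel 20 = 23 ∧
    InitializationLedger.m8SupNormLevel 20 = 22 ∧ step6CoordLevel 20 = 23 ∧ targetM8 20 = 20 ∧ m8Slack 20 = 2 ∧
    targetM0PT 20 - InitializationLedger.targetM0 20 = 9 := by decide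

end Literature.Geometry.Lorentzian.KlainermanSzeftel2021.FrameChangeLedger
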